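import Summits.ResolutionOfSingularities.ResolutionOfSingularities.Theorems.HomologicalConductorNoZenoBirthDefs
import Summits.ResolutionOfSingularities.ResolutionOfSingularities.Theorems.SyzygyFlatteningHigherRankTerminationTowerStageBasic
import Summits.ResolutionOfSingularities.ResolutionOfSingularities.Theorems.SyzygyFlatteningHigherRankTerminationLocAt
import Literature.RingTheory.CohomologyAnnihilator.Basic
import Literature.AlgebraicGeometry.Resolution.LocalBlowup
import HarnessLib

/-!
# Crux `NoZeno` (stmt-ResolutionOfSingularities-16483), line `birth` — stub `stub_dominanceInvariance`

Route `ResolutionOfSingularities/HomologicalConductor`, crux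
`Summit.ResolutionOfSingularities.ResolutionOfSingularities.Theses.HomologicalConductor.NoZeno`.
Registered stub 3 of the line `birth` (v2): DOMINANCE INVARIANCE of the canonical normalised
`ca`-tower (crux attack `Cruxes/NoZeno/CruxAttack-c1.md` §S3): if a valuation ring `O'` dominates
the `O`-tower of `A` — every stage lies in `O'`, and every element of a stage that is a unit of `O'`
is a unit of `O` — and the stages are noetherian, then `tower O' A m = tower O A m` for all `m`.

Proof: induction on `m`, keeping the two towers equal so far.
* `loc O' B = loc O B` whenever the admissible denominators agree
  (`∀ s ∈ B, s⁻¹ ∈ O ↔ s⁻¹ ∈ O'`): the generating sets coincide. For `B = A` (stage `0`) and for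
  `B = nrm (chart O T_m)` (⊆ `T_(m+1)`) this follows from domination plus "an `O`-unit `s` of a
  subring `B ⊆ T_(m+1)` is inverted in `T_(m+1) ⊆ O'`" (`T_(m+1) = loc O B` inverts `O`-units:
  `SyzygyFlattening.inv_mem_locAt`).
* `chart O' B = chart O B` for `B = T_m`: `ca B` does not see the valuation; an `O`-admissible `x`
  (`ca B · x⁻¹ ⊆ O`) is `O'`-admissible since `c' * x⁻¹ ∈ chart O B ⊆ T_(m+1) ⊆ O'`; an
  `O'`-admissible `x` is `O`-admissible: pick an `O`-minimal `x₀ ∈ ca B ∖ 0` (exists — `ca B` is the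
  image of the ideal `cohomologyAnnihilator ↥B`, finitely generated as `B` is noetherian; take a
  generator of minimal value, tree `exists_max_valuation`); if some `c' * x⁻¹ ∉ O` then
  `v(x) > v(c') ≥ v(x₀)`, so `x * x₀⁻¹ ∈ T_(m+1)` is a non-unit of `O` while its inverse
  `x₀ * x⁻¹ ∈ O'` by `O'`-admissibility — contradicting domination at stage `m+1`.
* `nrm` does not depend on the valuation ring.
-/

noncomputable section

-- single-problem summit: the doubled namespace component `ResolutionOfSingularities` is forced
set_option linter.dupNamespace false

namespace Summit.ResolutionOfSingularities.ResolutionOfSingularities.Theorems.NoZeno.Birth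

open Summit.ResolutionOfSingularities.ResolutionOfSingularities.Theses.HomologicalConductor

variable {k K : Type} [Field k] [Field K] [Algebra k K]

open Literature.AlgebraicGeometry.Resolution Literature.RingTheory.CohomologyAnnihilator

/-! ## Congruence of `loc` and `chart` in the valuation ring -/

/-- `loc O' B = loc O B` as soon as `O` and `O'` admit the same denominators from `B`
(`s⁻¹ ∈ O ↔ s⁻¹ ∈ O'` for `s ∈ B`): the two generating sets coincide. [folklore] -/
theorem di_loc_congr (O O' : ValuationSubring K) (B : Subalgebra k K)
    (h : ∀ s ∈ B, (s⁻¹ ∈ O ↔ s⁻¹ ∈ O')) : loc O' B = loc O B := by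
  have hS : {y : K | ∃ a ∈ B, ∃ s ∈ B, s⁻¹ ∈ O' ∧ y = a * s⁻¹} =
      {y : K | ∃ a ∈ B, ∃ s ∈ B, s⁻¹ ∈ O ∧ y = a * s⁻¹} := by
    ext y
    constructor
    · rintro ⟨a, ha, s, hs, hsO, rfl⟩
      exact ⟨a, ha, s, hs, (h s hs).mpr hsO, rfl⟩
    · rintro ⟨a, ha, s, hs, hsO, rfl⟩
      exact ⟨a, ha, s, hs, (h s hs).mp hsO, rfl⟩
  unfold loc
  rw [hS]

/-- `chart O' B = chart O B` as soon as `O` and `O'` have the same admissible denominators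
`x ∈ ca B ∖ 0` (`ca B * x⁻¹ ⊆ O ↔ ca B * x⁻¹ ⊆ O'`): `ca B` does not mention the valuation, so
the two generating sets coincide. [folklore] -/
theorem di_chart_congr (O O' : ValuationSubring K) (B : Subalgebra k K)
    (h : ∀ x ∈ ca B, x ≠ 0 →
      ((∀ c' ∈ ca B, c' * x⁻¹ ∈ O) ↔ (∀ c' ∈ ca B, c' * x⁻¹ ∈ O'))) :
    chart O' B = chart O B := by
  have hS : {y : K | ∃ c ∈ ca B, ∃ x ∈ ca B, x ≠ 0 ∧ (∀ c' ∈ ca B, c' * x⁻¹ ∈ O') ∧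
        y = c * x⁻¹} =
      {y : K | ∃ c ∈ ca B, ∃ x ∈ ca B, x ≠ 0 ∧ (∀ c' ∈ ca B, c' * x⁻¹ ∈ O) ∧
        y = c * x⁻¹} := by
    ext y
    constructor
    · rintro ⟨c, hc, x, hx, hx0, hadm, rfl⟩
      exact ⟨c, hc, x, hx, hx0, (h x hx hx0).mpr hadm, rfl⟩
    · rintro ⟨c, hc, x, hx, hx0, hadm, rfl⟩
      exact ⟨c, hc, x, hx, hx0, (h x hx hx0).mp hadm, rfl⟩
  unfold chart
  rw [hS]

/-- **`loc` only sees units.** If `O'` dominates `loc O B` — every element of `loc O B` lies in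
`O'` and is a unit of `O` as soon as it is a unit of `O'` — then `loc O' B = loc O B`: for
`s ∈ B ≤ loc O B`, `s⁻¹ ∈ O` puts `s⁻¹ = 1 * s⁻¹` in `loc O B ⊆ O'`, and `s⁻¹ ∈ O'` gives
`s⁻¹ ∈ O` by domination. [folklore] -/
theorem di_loc_eq_of_dominated (O O' : ValuationSubring K) (B : Subalgebra k K)
    (h : ∀ s ∈ loc O B, s ∈ O' ∧ (s⁻¹ ∈ O' → s⁻¹ ∈ O)) : loc O' B = loc O B := by
  refine di_loc_congr O O' B fun s hs => ⟨fun hsO => ?_, fun hsO' => ?_⟩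
  · by_cases hs0 : s = 0
    · rw [hs0, inv_zero]
      exact O'.zero_mem
    · have hgen : s⁻¹ ∈ loc O B :=
        Algebra.subset_adjoin ⟨1, B.one_mem, s, hs, hsO, (one_mul _).symm⟩
      exact (h _ hgen).1
  · have hsL : s ∈ loc O B := by
      rw [loc_eq_locAt]
      exact SyzygyFlattening.self_le_locAt O B hs
    exact (h s hsL).2 hsO'

/-! ## An `O`-minimal element of `ca B` for noetherian `B ⊆ O` -/

/-- **Existence of an admissible denominator.** For a noetherian `B ⊆ O` with `ca B ≠ 0` there
is a nonzero `x₀ ∈ ca B` of minimal value: `c * x₀⁻¹ ∈ O` for every `c ∈ ca B`. Indeed `ca B`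
is the image of the finitely generated ideal `ca(↥B) = (g₁, …, g_r)`
(`mem_cohomologyAnnihilator_iff'`); a nonzero generator `x₀` of maximal `O.valuation` (tree
`exists_max_valuation`) divides in `O` every generator, hence every `B`-linear combination of
them (`B ⊆ O`). [cite: NovacoskiSpivakovsky2014, Def. 2.11] -/
theorem di_exists_admissible (O : ValuationSubring K) (B : Subalgebra k K) [IsNoetherianRing ↥B]
    (hBO : ∀ b ∈ B, b ∈ O) {x : K} (hx : x ∈ ca B) (hx0 : x ≠ 0) :
    ∃ x₀ ∈ ca B, x₀ ≠ 0 ∧ ∀ c ∈ ca B, c * x₀⁻¹ ∈ O := by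
  classical
  -- `ca B` is the image of the ideal `cohomologyAnnihilator ↥B`
  have toI : ∀ {z : K} (hz : z ∈ ca B),
      (⟨z, ca_subset B hz⟩ : ↥B) ∈ cohomologyAnnihilator ↥B := by
    intro z hz
    obtain ⟨hzB, n, hn⟩ := hz
    exact mem_cohomologyAnnihilator_iff'.mpr ⟨n, hn⟩
  -- the cohomology annihilator ideal of the noetherian ring `B` is finitely generated
  obtain ⟨G, hG⟩ := IsNoetherian.noetherian (cohomologyAnnihilator ↥B)
  -- not every generator vanishes, as `x ≠ 0` lies in the ideal
  have hne : ∃ g ∈ G, ((g : ↥B) : K) ≠ 0 := by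
    by_contra! hcon
    apply hx0
    have hxI := toI hx
    rw [← hG, Submodule.span_eq_bot.mpr fun g hg => Subtype.ext (hcon g hg),
      Submodule.mem_bot] at hxI
    exact congrArg Subtype.val hxI
  -- a nonzero generator of maximal valuation
  obtain ⟨g₀, hg₀, hg₀0, hmax⟩ := exists_max_valuation O G (fun g : ↥B => (g : K)) hne
  have hg₀I : g₀ ∈ cohomologyAnnihilator ↥B := by
    rw [← hG]
    exact Submodule.subset_span hg₀
  obtain ⟨n₀, hn₀⟩ := mem_cohomologyAnnihilator_iff'.mp hg₀I
  refine ⟨g₀, ⟨g₀.2, n₀, hn₀⟩, hg₀0, fun c hc => ?_⟩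
  have hcI : (⟨c, ca_subset B hc⟩ : ↥B) ∈ Submodule.span ↥B (↑G : Set ↥B) := by
    rw [hG]
    exact toI hc
  suffices hdiv : ∀ v ∈ Submodule.span ↥B (↑G : Set ↥B), (v : K) * ((g₀ : ↥B) : K)⁻¹ ∈ O from
    hdiv _ hcI
  intro v hv
  induction hv using Submodule.span_induction with
  | mem w hw =>
    rw [← O.valuation_le_one_iff, map_mul, map_inv₀]
    exact mul_inv_le_one_of_le₀ (hmax w hw) zero_le
  | zero =>
    rw [ZeroMemClass.coe_zero, zero_mul]
    exact O.zero_mem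
  | add a b _ _ ha hb =>
    rw [AddMemClass.coe_add, add_mul]
    exact add_mem ha hb
  | smul r a _ ha =>
    rw [smul_eq_mul, MulMemClass.coe_mul, mul_assoc]
    exact mul_mem (hBO r r.2) ha

/-! ## `chart` only sees units -/

/-- **`chart` only sees units.** For a noetherian `B ⊆ O`: if `O'` dominates `chart O B` — every
element of `chart O B` lies in `O'` and is a unit of `O` as soon as it is a unit of `O'` — then
`chart O' B = chart O B`. An `O`-admissible `x` is `O'`-admissible because each `c' * x⁻¹` is a
generator of `chart O B ⊆ O'`; an `O'`-admissible `x` is `O`-admissible: with `x₀` `O`-minimal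
(`di_exists_admissible`), `x * x₀⁻¹ ∈ chart O B` has inverse `x₀ * x⁻¹ ∈ O'`, hence in `O` by
domination, and `c' * x⁻¹ = (c' * x₀⁻¹) * (x₀ * x⁻¹) ∈ O`. [folklore] -/
theorem di_chart_eq_of_dominated (O O' : ValuationSubring K) (B : Subalgebra k K)
    [IsNoetherianRing ↥B] (hBO : ∀ b ∈ B, b ∈ O)
    (h : ∀ s ∈ chart O B, s ∈ O' ∧ (s⁻¹ ∈ O' → s⁻¹ ∈ O)) : chart O' B = chart O B := by
  refine di_chart_congr O O' B fun x hx hx0 => ⟨fun hadm c' hc' => ?_, fun hadm' c' hc' => ?_⟩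
  · have hgen : c' * x⁻¹ ∈ chart O B :=
      Algebra.subset_adjoin (Or.inr ⟨c', hc', x, hx, hx0, hadm, rfl⟩)
    exact (h _ hgen).1
  · obtain ⟨x₀, hx₀, hx₀0, hmin⟩ := di_exists_admissible O B hBO hx hx0
    have hgen : x * x₀⁻¹ ∈ chart O B :=
      Algebra.subset_adjoin (Or.inr ⟨x, hx, x₀, hx₀, hx₀0, hmin, rfl⟩)
    have hO : x₀ * x⁻¹ ∈ O := by
      have hx₀x := (h _ hgen).2
      rw [mul_inv_rev, inv_inv] at hx₀x
      exact hx₀x (hadm' x₀ hx₀)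
    have key : c' * x₀⁻¹ * (x₀ * x⁻¹) ∈ O := mul_mem (hmin c' hc') hO
    rwa [mul_assoc, inv_mul_cancel_left₀ hx₀0] at key

/-- **STUB `stub_dominanceInvariance` (line `birth` of crux `NoZeno`).** A valuation ring `O'`
dominating the `O`-tower of `A` (noetherian stages) has the same tower: `tower O' A m = tower O A m`.
[cite: ZariskiSamuel1960, VI §5] -/
theorem stub_dominanceInvariance (k K : Type) [Field k] [Field K] [Algebra k K]
    (O O' : ValuationSubring K) (A : Subalgebra k K) (hk : ∀ c : k, algebraMap k K c ∈ O)
    (hAO : A.toSubring ≤ O.toSubring) (hN : ∀ m : ℕ, IsNoetherianRing ↥(tower O A m))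
    (hdom : ∀ m : ℕ, ∀ s ∈ tower O A m, s ∈ O' ∧ (s⁻¹ ∈ O' → s⁻¹ ∈ O)) (m : ℕ) :
    tower O' A m = tower O A m := by
  -- every stage of the `O`-tower lies in `O` (`k ⊆ O`, `A ⊆ O`; the chart generators `c * x⁻¹`
  -- are in `O` by the admissibility clause with `c' := c`)
  have hTO : ∀ n : ℕ, (tower O A n).toSubring ≤ O.toSubring := by
    intro n
    induction n with
    | zero =>
      rw [tower_zero, loc_eq_locAt]
      exact SyzygyFlattening.locAt_toSubring_le O hk hAO
    | succ n ih =>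
      have hc : (chart O (tower O A n)).toSubring ≤ O.toSubring := by
        refine SyzygyFlattening.adjoin_toSubring_le_valuationSubring O hk ?_
        rintro y (hy | ⟨c, hcc, x, -, -, hadm, rfl⟩)
        · exact ih (Subalgebra.mem_toSubring.mpr hy)
        · exact hadm c hcc
      rw [tower_succ, loc_eq_locAt, nrm_eq_nrm]
      exact SyzygyFlattening.locAt_toSubring_le O hk (SyzygyFlattening.nrm_toSubring_le O hk hc)
  induction m with
  | zero =>
    have hd := hdom 0
    rw [tower_zero] at hd
    rw [tower_zero, tower_zero]
    exact di_loc_eq_of_dominated O O' A hd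
  | succ m ih =>
    haveI := hN m
    have hBO : ∀ b ∈ tower O A m, b ∈ O := fun b hb => hTO m (Subalgebra.mem_toSubring.mpr hb)
    have hd := hdom (m + 1)
    rw [tower_succ] at hd
    rw [tower_succ, tower_succ, ih]
    -- `chart O T_m ≤ nrm (chart O T_m) ≤ loc O (nrm (chart O T_m)) = T_(m+1)` is dominated by `O'`
    have hcT : chart O (tower O A m) ≤ loc O (nrm (chart O (tower O A m))) := by
      rw [loc_eq_locAt, nrm_eq_nrm]
      exact (SyzygyFlattening.self_le_nrm _).trans (SyzygyFlattening.self_le_locAt O _)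
    have hchart : chart O' (tower O A m) = chart O (tower O A m) :=
      di_chart_eq_of_dominated O O' (tower O A m) hBO fun s hs => hd s (hcT hs)
    rw [hchart]
    exact di_loc_eq_of_dominated O O' _ hd

end Summit.ResolutionOfSingularities.ResolutionOfSingularities.Theorems.NoZeno.Birth

end
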